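import Summits.HubbardSuperconductivity.HubbardSuperconductivity.Theorems.AnisotropyChordTransferFibre3TwoHoleBS

/-!
# Route `AnisotropyChord` / H0 rotor rung: PROP BS — COVARIANCE of the certificates (translations and the point group `D₄`): pairs reduce to `ζ = {0, d}`, `d` modulo symmetry

Fifth file of PROP BS (memo ROTOR-THEORY-21 §314, §318–§319; theory seat `hubbard-h0-rotor-theory-1`).  `TwoHoleGap L g` quantifies
over ALL ordered pairs `z₁ ≠ z₂`; the per-L tables and the analytic tail of the memo are per separation `d` in a fundamental domain
of the square lattice's symmetry group.  This file transports dual certificates (`…Fibre3TwoHoleBS.DualCert`) along the symmetries: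
* `dualCert_map` — abstract transport along a bijection `σ` of the torus that preserves the Green's function of differences
  (`G̃_g(σx − σy) = G̃_g(x − y)`) and the boundary masses;
* `dualCert_translate` (`ζ ↦ ζ + t`) and ★ `twoHoleGap_of_dualCert_origin`: `TwoHoleGap L g` ⟸ dual certificates for `ζ = {0, d}`,
  `d ≠ 0` (with `2 ≤ L`, `g < ε₁`);
* point group: `greenW_swap`, `greenW_mirror`, `greenW_negArg` (invariance of `G̃_g` under `(x,y) ↦ (y,x)`, `(−x,y)`, `−r`; with
  `epsT_mirror`, `phase_mirror_mirror`), and `dualCert_swap`, `dualCert_mirror`, `dualCert_neg` — so a certificate for `d` serves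
  the whole `D₄`-orbit of `d`.
Prover seat `hubbard-h0-rotor-p2` g2; helper for stmt-HubbardSuperconductivity-19089 (`--supports`, helper class).
WHAT THIS IS NOT: nothing here proves superconductivity in the Hubbard model; the rotor TARGET as originally worded stays
FALSE (g15 verdict).  Bookkeeping for ONE input (HOLE₂) of ONE conditional reduction (rung 19089).  Mathlib + tree imports only;
no sorry, no axioms.
-/

set_option linter.dupNamespace false

noncomputable section

open scoped BigOperators
open Complex Finset

namespace Summit.HubbardSuperconductivity.HubbardSuperconductivity.Theorems.AnisotropyChord.Transfer.Fibre3

namespace TwoHoleBS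

variable (L : ℕ) [NeZero L]

/-! ## Covariance: translations and the point group of the square lattice transport certificates (pairs reduce to `ζ = {0, d}`, `d` modulo `D₄`) -/

/-- transport of a dual certificate along a bijection of the torus preserving the Green's function of differences and the
boundary masses (translations, and the point group `D₄`). [folklore] -/
theorem dualCert_map {g : ℝ} {z₁ z₂ : Tor L} (σ : Tor L ≃ Tor L)
    (hG : ∀ x y : Tor L, greenW L g (σ x - σ y) = greenW L g (x - y))
    (hnbr : ∀ (φ : Tor L → ℂ) (z : Tor L), nbr L (fun x => φ (σ x)) z = nbr L φ (σ z))
    (h : DualCert L g z₁ z₂) : DualCert L g (σ z₁) (σ z₂) := by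
  intro φ h1 h2 hsum
  have hsum' : ∑ x : Tor L, φ (σ x) = 0 := by rw [Equiv.sum_comp σ φ]; exact hsum
  obtain ⟨c', hc'⟩ := h (fun x => φ (σ x)) h1 h2 hsum'
  refine ⟨fun x => c' (σ.symm x), ?_⟩
  have hi : ∑ x : Tor L, (starRingEnd ℂ) (c' (σ.symm x)) * φ x
      = ∑ y : Tor L, (starRingEnd ℂ) (c' y) * φ (σ y) := by
    rw [← Equiv.sum_comp σ]
    simp only [Equiv.symm_apply_apply]
  have hq : greenQF L g (fun x => c' (σ.symm x)) = greenQF L g c' := by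
    unfold greenQF
    rw [← Equiv.sum_comp σ]
    refine Finset.sum_congr rfl fun x _ => ?_
    rw [← Equiv.sum_comp σ]
    refine Finset.sum_congr rfl fun y _ => ?_
    simp only [Equiv.symm_apply_apply]
    rw [hG]
  rw [← hnbr φ z₁, ← hnbr φ z₂, hi, hq]
  exact hc'

omit [NeZero L] in
/-- boundary masses under translation. [folklore] -/
theorem nbr_translate (φ : Tor L → ℂ) (z t : Tor L) :
    nbr L (fun x => φ (x + t)) z = nbr L φ (z + t) := by
  unfold nbr
  congr 1
  refine List.map_congr_left fun e _ => ?_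
  rw [add_right_comm]

/-- **translation covariance** of dual certificates. [folklore] -/
theorem dualCert_translate {g : ℝ} {z₁ z₂ : Tor L} (t : Tor L) (h : DualCert L g z₁ z₂) :
    DualCert L g (z₁ + t) (z₂ + t) := by
  have := dualCert_map L (Equiv.addRight t) (fun x y => by simp) (fun φ z => nbr_translate L φ z t) h
  simpa using this

/-- **PROP BS with the pair anchored at the origin:** certificates for `ζ = {0, d}`, `d ≠ 0`, suffice. [folklore] -/
theorem twoHoleGap_of_dualCert_origin (hL : 2 ≤ L) {g : ℝ} (hg : g < eps1 L)
    (h : ∀ d : Tor L, d ≠ 0 → DualCert L g 0 d) : TwoHoleGap L g := by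
  refine twoHoleGap_of_dualCert L hL hg fun z₁ z₂ hne => ?_
  have hd : z₂ - z₁ ≠ 0 := sub_ne_zero.mpr (Ne.symm hne)
  have := dualCert_translate L z₁ (h (z₂ - z₁) hd)
  simpa using this

/-- `ε(−k₁, k₂) = ε(k)`. [folklore] -/
theorem epsT_mirror (k : Tor L) : epsT L (-k.1, k.2) = epsT L k := by
  have h1 := sum_phase_nn L k
  have h2 := sum_phase_nn L (-k.1, k.2)
  have e1 : phase L (-k.1, k.2) (ex L) = phase L k (-ex L) := by
    rw [phase_eq_phZ, phase_eq_phZ]; congr 1; unfold dotZ ex; simp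
  have e2 : phase L (-k.1, k.2) (-ex L) = phase L k (ex L) := by
    rw [phase_eq_phZ, phase_eq_phZ]; congr 1; unfold dotZ ex; simp
  have e3 : phase L (-k.1, k.2) (ey L) = phase L k (ey L) := by
    rw [phase_eq_phZ, phase_eq_phZ]; congr 1; unfold dotZ ey; simp
  have e4 : phase L (-k.1, k.2) (-ey L) = phase L k (-ey L) := by
    rw [phase_eq_phZ, phase_eq_phZ]; congr 1; unfold dotZ ey; simp
  rw [e1, e2, e3, e4] at h2
  have : ((4 - 2 * epsT L (-k.1, k.2) : ℝ) : ℂ) = ((4 - 2 * epsT L k : ℝ) : ℂ) := by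
    rw [← h1, ← h2]; ring
  have := Complex.ofReal_injective this
  linarith

/-- `φ_{(−k₁,k₂)}((−r₁,r₂)) = φ_k(r)`. [folklore] -/
theorem phase_mirror_mirror (k r : Tor L) : phase L (-k.1, k.2) (-r.1, r.2) = phase L k r := by
  rw [phase_eq_phZ, phase_eq_phZ]
  congr 1
  unfold dotZ
  simp

/-- `G̃_g` is invariant under `(x,y) ↦ (y,x)`. [folklore] -/
theorem greenW_swap (g : ℝ) (r : Tor L) : greenW L g (r.2, r.1) = greenW L g r := by
  unfold greenW
  congr 1
  rw [← Equiv.sum_comp (Equiv.prodComm (ZMod L) (ZMod L))]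
  refine Finset.sum_congr rfl fun k _ => ?_
  simp only [Equiv.prodComm_apply, Prod.swap]
  have hk : ((k.2, k.1) = (0 : Tor L)) ↔ (k = 0) := by
    constructor
    · intro h; ext <;> simp_all [Prod.ext_iff]
    · intro h; simp [h]
  rw [epsT_swap]
  have hp : phase L (k.2, k.1) (r.2, r.1) = phase L k r := phase_swap_swap L k r
  simp only [hk, hp]

/-- `G̃_g` is invariant under `(x,y) ↦ (−x,y)`. [folklore] -/
theorem greenW_mirror (g : ℝ) (r : Tor L) : greenW L g (-r.1, r.2) = greenW L g r := by
  unfold greenW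
  congr 1
  rw [← Equiv.sum_comp ((Equiv.neg (ZMod L)).prodCongr (Equiv.refl (ZMod L)))]
  refine Finset.sum_congr rfl fun k _ => ?_
  simp only [Equiv.prodCongr_apply, Equiv.neg_apply, Equiv.coe_refl, Prod.map, id_eq]
  have hk : ((-k.1, k.2) = (0 : Tor L)) ↔ (k = 0) := by
    constructor
    · intro h; ext <;> simp_all [Prod.ext_iff]
    · intro h; simp [h]
  rw [epsT_mirror]
  have hp : phase L (-k.1, k.2) (-r.1, r.2) = phase L k r := phase_mirror_mirror L k r
  simp only [hk, hp]

/-- `G̃_g` is even. [folklore] -/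
theorem greenW_negArg (g : ℝ) (r : Tor L) : greenW L g (-r) = greenW L g r := by
  apply Complex.ext
  · rw [greenW_re, greenW_re, Gres_neg]
  · rw [greenW_im, greenW_im]

/-- **swap covariance** `(x,y) ↦ (y,x)`. [folklore] -/
theorem dualCert_swap {g : ℝ} {z₁ z₂ : Tor L} (h : DualCert L g z₁ z₂) :
    DualCert L g (z₁.2, z₁.1) (z₂.2, z₂.1) := by
  have := dualCert_map L (Equiv.prodComm (ZMod L) (ZMod L))
    (fun x y => by
      simp only [Equiv.prodComm_apply, Prod.swap]
      rw [show ((x.2, x.1) : Tor L) - (y.2, y.1) = ((x - y).2, (x - y).1) by rfl, greenW_swap])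
    (fun φ z => by
      unfold nbr
      rw [nnList_map_sum, nnList_map_sum]
      simp only [Equiv.prodComm_apply, Prod.swap, ex, ey, Prod.snd_add, Prod.fst_add, Prod.neg_mk, neg_zero,
        Prod.mk_add_mk, add_zero, add_comm]
      ring) h
  exact this

/-- **mirror covariance** `(x,y) ↦ (−x,y)`. [folklore] -/
theorem dualCert_mirror {g : ℝ} {z₁ z₂ : Tor L} (h : DualCert L g z₁ z₂) :
    DualCert L g (-z₁.1, z₁.2) (-z₂.1, z₂.2) := by
  have := dualCert_map L ((Equiv.neg (ZMod L)).prodCongr (Equiv.refl (ZMod L)))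
    (fun x y => by
      simp only [Equiv.prodCongr_apply, Equiv.neg_apply, Equiv.coe_refl, Prod.map, id]
      rw [show ((-x.1, x.2) : Tor L) - (-y.1, y.2) = (-(x - y).1, (x - y).2) by
        ext <;> simp [sub_eq_add_neg, add_comm], greenW_mirror])
    (fun φ z => by
      unfold nbr
      rw [nnList_map_sum, nnList_map_sum]
      simp only [Equiv.prodCongr_apply, Equiv.neg_apply, Equiv.coe_refl, Prod.map, id_eq, ex, ey,
        Prod.neg_mk, neg_zero, neg_add_rev, neg_neg, Prod.mk_add_mk, add_zero, add_comm]) h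
  exact this

/-- **inversion covariance** `r ↦ −r`. [folklore] -/
theorem dualCert_neg {g : ℝ} {z₁ z₂ : Tor L} (h : DualCert L g z₁ z₂) : DualCert L g (-z₁) (-z₂) := by
  have := dualCert_map L (Equiv.neg (Tor L))
    (fun x y => by simp only [Equiv.neg_apply]; rw [← greenW_negArg]; congr 1; abel)
    (fun φ z => by
      unfold nbr
      rw [nnList_map_sum, nnList_map_sum]
      simp only [Equiv.neg_apply, neg_add_rev, neg_neg]
      ring_nf) h
  simpa using this

end TwoHoleBS

end Summit.HubbardSuperconductivity.HubbardSuperconductivity.Theorems.AnisotropyChord.Transfer.Fibre3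

end
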